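import Summits.BirchSwinnertonDyer.BirchSwinnertonDyer.Theorems.RamifiedSevenEllipticUnitsQuadraticRamificationOfPinning
import Literature.NumberTheory.QuadraticForms.GlobalSquareTheorem
import HarnessLib

set_option linter.dupNamespace false
set_option autoImplicit false

/-!
# K7r value crux `EllipticUnitValueSevenOfGZK` (stmt-BirchSwinnertonDyer-19945), line `rubin-formula-zp`
# v4.2 — CONDUCTOR EXPONENT ONE at the frame prime WITHOUT Gross (8.2.7)
# (cell `bsd-cm`, seat `bsd-cm-k7r-c3` g13; helper, `--supports` 19945; companion of
# `…QuadraticRamificationOfPinning.lean`; nothing about BSD asserted)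

HONEST FRAMING. Seat g11 derived `f(φ_𝔭) = 1` for the Deuring-type characters pinned to a 𝒞₇ curve from
Gross LNM 776 (8.2.7) (`QuadraticRamification.hasConductorExponentAt_frame_one_of_gross`). After
`…QuadraticRamificationOfPinning.lean` (φ RAMIFIED at `𝔭` from the `L`-pinning alone) and g11's
`sq_isUnramifiedAt_everywhere_of_unitValues_of_rigidityAtZp` (`φ²` unramified everywhere, from
Deuring-with-unit-values + the tree theorem H_Rig⁰ p515907), the exponent follows from a purely LOCAL fact at
an odd place: a character ramified at `v` with unramified square has conductor exponent exactly `1`, because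
every principal unit of `𝒪_v` is the square of a unit (local square theorem, O'Meara 63:1b, tree
`QuadraticForms.isSquare_of_valued_sub_one_lt`). So `f(φ_𝔭) = 1` on 𝒞₇ holds modulo the single print fact
`Deuring_exists_heckeCharacter_of_maximalCM_withUnitValues` (`hasConductorExponentAt_frame_one_of_unitValues`);
not consumed by the v4.2 skeleton (recorded for the K8/inert and functional-equation readings, where the
conductor of `ψ` at the CM prime enters). Nothing about BSD is proved or claimed.

References: O. T. O'Meara, *Introduction to Quadratic Forms* (1963) §63A [Omeara1963]; J. Neukirch,
*Algebraic Number Theory* (1999) VII (6.10) [NeukirchANT1999]; J. Silverman, *Advanced Topics* (1994)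
II Thm. 9.2 [SilvermanATAEC1994]; cell texts STATUS 2026-08-27 k7r-c3 g11 07:24Z, g13 09:16Z/09:3xZ.
-/

noncomputable section

open scoped Classical
open Filter NumberField IsDedekindDomain WeierstrassCurve
  Literature.NumberTheory.GaloisRepresentations
  Literature.NumberTheory.EllipticCurves
  Literature.NumberTheory.EllipticCurves.Rank1Residual
  Summit.BirchSwinnertonDyer.Rank1Residual Summit.BirchSwinnertonDyer.Rank1Residual.X12
  Summit.BirchSwinnertonDyer.Rank1Residual.X12.O11

namespace Summit.BirchSwinnertonDyer.BirchSwinnertonDyer.Theorems.RamifiedSevenEllipticUnits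

namespace QuadraticRamification

/-! ## §1. The local lemma: ramified with unramified square at an odd place ⇒ `f = 1` -/

section Local

variable {K : Type} [Field K] [NumberField K]
/-- **`f(χ_v) = 1` from: `χ` ramified at `v`, `χ²` unramified at `v`, `v ∤ 2`.** A principal unit
`u ∈ 1 + 𝔭_v` is a local square `u = w²` (`v(u − 1) < 1 = v(4)`, the local square theorem
`isSquare_of_valued_sub_one_lt`, O'Meara 63:1b) with `w` a unit, so `χ_v(u) = χ_v(w)² = (χ²)_v(w) = 1`:
`χ_v` is trivial on `U_v^{(1)}`; it is not trivial on `U_v^{(0)}` because `χ` is ramified at `v`.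
[cite: Omeara1963, §63A Cor. 63:1b] [cite: NeukirchANT1999, Ch. VII §6 (6.10)] -/
theorem hasConductorExponentAt_one_of_sq_isUnramifiedAt {χ : HeckeCharacter K}
    {v : HeightOneSpectrum (𝓞 K)} (h2 : (2 : 𝓞 K) ∉ v.asIdeal)
    (hram : ¬ χ.IsUnramifiedAt v) (hsq : (χ ^ 2).IsUnramifiedAt v) :
    χ.HasConductorExponentAt v 1 := by
  refine ⟨?_, fun g hg ↦ ?_⟩
  · intro u hu
    have hu1 : Valued.v (((u : v.adicCompletionIntegers K) : v.adicCompletion K)) = 1 :=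
      HeightOneSpectrum.adicCompletionIntegers.isUnit_iff_valued_eq_one.mp (Units.isUnit u)
    -- `u` is a local square
    have hlt1 : Valued.v ((((u : v.adicCompletionIntegers K)) : v.adicCompletion K) - 1) < 1 :=
      lt_of_le_of_lt hu (by rw [← WithZero.exp_zero, WithZero.exp_lt_exp]; norm_num)
    have hlt : Valued.v ((((u : v.adicCompletionIntegers K)) : v.adicCompletion K) - 1) <
        Valued.v (4 : v.adicCompletion K) := by
      rw [Literature.NumberTheory.QuadraticForms.valued_four_eq_one_of_notMem v h2]
      exact hlt1
    obtain ⟨r, hr⟩ := Literature.NumberTheory.QuadraticForms.isSquare_of_valued_sub_one_lt K v hlt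
    have hr0 : r ≠ 0 := by
      rintro rfl
      rw [mul_zero] at hr
      rw [hr, map_zero] at hu1
      exact zero_ne_one hu1
    have hrv : Valued.v r = 1 := by
      have h := hu1
      rw [hr, map_mul] at h
      rcases lt_trichotomy (Valued.v r) 1 with hlt' | heq | hgt
      · exact absurd h (ne_of_lt (mul_lt_one_of_nonneg_of_lt_one_left zero_le hlt' hlt'.le))
      · exact heq
      · exact absurd h (ne_of_gt (one_lt_mul_of_lt_of_le hgt hgt.le))
    set w : (v.adicCompletion K)ˣ := Units.mk0 r hr0 with hw_def
    have hw : Valued.v (w : v.adicCompletion K) = 1 := hrv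
    have hχw : (χ ^ 2) (localUnits v w) = 1 :=
      (HeckeCharacter.isUnramifiedAt_iff_forall_valued_eq_one.mp hsq) w hw
    have hmap : Units.map ((v.adicCompletionIntegers K).subtype : _ →* _) u = w ^ 2 := by
      apply Units.ext
      show (((u : v.adicCompletionIntegers K)) : v.adicCompletion K) =
        ((w ^ 2 : (v.adicCompletion K)ˣ) : v.adicCompletion K)
      rw [Units.val_pow_eq_pow_val, hw_def, Units.val_mk0, sq]
      exact hr
    rw [hmap, HeckeCharacter.localComponent_apply, map_pow, map_pow]
    rw [HeckeCharacter.pow_apply] at hχw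
    exact hχw
  · interval_cases g
    rw [HeckeCharacter.isTrivialOnHigherUnitsAt_zero_iff]
    exact hram

omit [NumberField K] in
/-- `2 ∉ 𝔭` for a prime `𝔭 ∋ 7` (`1 = 7 − 3·2`). [folklore] -/
theorem two_notMem_of_seven_mem {𝔭 : HeightOneSpectrum (𝓞 K)} (h7 : ((7 : ℕ) : 𝓞 K) ∈ 𝔭.asIdeal) :
    (2 : 𝓞 K) ∉ 𝔭.asIdeal := by
  intro h2
  apply 𝔭.isPrime.ne_top
  rw [Ideal.eq_top_iff_one]
  have h := 𝔭.asIdeal.sub_mem h7 (𝔭.asIdeal.mul_mem_left 3 h2)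
  have h1 : ((7 : ℕ) : 𝓞 K) - 3 * 2 = 1 := by norm_num
  rwa [h1] at h

end Local

/-! ## §2. 𝒞₇: conductor exponent one at the frame prime, modulo Deuring-with-unit-values only -/

section Frame

variable {K : Type} [Field K] [NumberField K] {𝔭 : HeightOneSpectrum (𝓞 K)}
  {W : WeierstrassCurve ℚ} [W.IsElliptic] [W.IsGloballyMinimal]
  {W' : WeierstrassCurve ℚ} {C : VariableChange ℚ}

/-- **Conductor exponent ONE at the frame prime on 𝒞₇ WITHOUT Gross (8.2.7)**: for `W ∈ 𝒞₇`, an O11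
frame `IsFrame W 7 K 𝔭 W' C`, every curve `V/ℚ` with CM and the same CM field, every `cK ≠ 1` and EVERY
Hecke character `φ` of `K` pinned to `V`: `f(φ_𝔭) = 1` — `φ` is ramified at `𝔭`
(`not_isUnramifiedAt_frame`, from the `L`-pinning) and `φ²` is unramified at `𝔭` (seat g11,
Deuring-with-unit-values + the tree theorem H_Rig⁰ `pinnedCharacterRigidityAtZp W 7`), and `2 ∉ 𝔭`.
Gross-free counterpart of `hasConductorExponentAt_frame_one_of_gross`; CONDITIONAL on the print fact
`Deuring_exists_heckeCharacter_of_maximalCM_withUnitValues` only (infinity type / conj-equivariance of `φ`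
not needed). Nothing about BSD. [cite: SilvermanATAEC1994, Ch. II Thm. 9.1 (i) and Thm. 9.2]
[cite: Omeara1963, §63A Cor. 63:1b] -/
theorem hasConductorExponentAt_frame_one_of_unitValues [Fact (Nat.Prime 7)]
    [W'.IsElliptic] [W'.IsGloballyMinimal]
    (hDU : Deuring_exists_heckeCharacter_of_maximalCM_withUnitValues) (hC : ClassCSeven W)
    (hF : IsFrame W 7 K 𝔭 W' C) (V : WeierstrassCurve ℚ) [V.IsElliptic] (hV : V.HasCM)
    (hVj : cmFieldDiscrOfJ V.j = cmFieldDiscrOfJ W.j) (cK : K ≃ₐ[ℚ] K) (hcK : cK ≠ 1)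
    (φ : HeckeCharacter K) (hpin : ∀ s : ℂ, 3 / 2 < s.re → heckeLFunction φ s = V.LSeries s) :
    φ.HasConductorExponentAt 𝔭 1 :=
  hasConductorExponentAt_one_of_sq_isUnramifiedAt
    (two_notMem_of_seven_mem (by simpa using hF.2.2.2.2.2.1))
    (not_isUnramifiedAt_frame hC hF V hV hVj φ hpin)
    (sq_isUnramifiedAt_everywhere_of_unitValues_of_rigidityAtZp hDU hC (pinnedCharacterRigidityAtZp W 7)
      K 𝔭 W' C hF V hV hVj cK hcK φ hpin 𝔭)

/-- **`𝔭`-part of H_QR with the exact exponent, class level**: for every globally minimal `W ∈ 𝒞₇` and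
every Deuring-type character pinned to a curve of an O11 frame, `¬ φ` unramified at `𝔭`, `φ²` unramified
at `𝔭`, and `f(φ_𝔭) = 1` — all modulo Deuring-with-unit-values only. [cite: SilvermanATAEC1994, Ch. II Thm. 9.2] -/
theorem not_isUnramifiedAt_and_sq_isUnramifiedAt_and_hasConductorExponentAt_frame [Fact (Nat.Prime 7)]
    [W'.IsElliptic] [W'.IsGloballyMinimal]
    (hDU : Deuring_exists_heckeCharacter_of_maximalCM_withUnitValues) (hC : ClassCSeven W)
    (hF : IsFrame W 7 K 𝔭 W' C) (V : WeierstrassCurve ℚ) [V.IsElliptic] (hV : V.HasCM)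
    (hVj : cmFieldDiscrOfJ V.j = cmFieldDiscrOfJ W.j) (cK : K ≃ₐ[ℚ] K) (hcK : cK ≠ 1)
    (φ : HeckeCharacter K) (hpin : ∀ s : ℂ, 3 / 2 < s.re → heckeLFunction φ s = V.LSeries s) :
    ¬ φ.IsUnramifiedAt 𝔭 ∧ (φ ^ 2).IsUnramifiedAt 𝔭 ∧ φ.HasConductorExponentAt 𝔭 1 :=
  ⟨not_isUnramifiedAt_frame hC hF V hV hVj φ hpin,
    sq_isUnramifiedAt_everywhere_of_unitValues_of_rigidityAtZp hDU hC (pinnedCharacterRigidityAtZp W 7)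
      K 𝔭 W' C hF V hV hVj cK hcK φ hpin 𝔭,
    hasConductorExponentAt_frame_one_of_unitValues hDU hC hF V hV hVj cK hcK φ hpin⟩

end Frame

end QuadraticRamification

end Summit.BirchSwinnertonDyer.BirchSwinnertonDyer.Theorems.RamifiedSevenEllipticUnits

end
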